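import Literature.Analysis.FunctionSpaces.TorusDerivativeContinuityInTime
import Mathlib.Analysis.Calculus.ParametricIntervalIntegral
import Mathlib.MeasureTheory.Integral.IntervalIntegral.FundThmCalculus
import Mathlib.Analysis.Calculus.MeanValue
import HarnessLib

/-!
# Frame regularity of the flow of a field continuous in time and smooth in space
# (the `ad-ideate` package FR1–FR4 for the flow Jacobian `J = 1 + ∇D`)

Analysis/ODE proof file (theorems only; no definitions, no named facts). Setting (generic dimension):
a velocity field `b : ℝ × T^d → ℝ^d` and a displacement `D : ℝ × T^d → ℝ^d` on the time window
`[0, T]` such that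
* `b` and `D` have space–time lifts continuous on `[0,T] × ℝ^d`, smooth slices, and order-by-order
  bounds `‖Dⁿ(lift (b t))‖, ‖Dⁿ(lift (D t))‖ ≤ C_n` uniform in `t ∈ [0,T]` — the verbatim clauses of
  `LagrangianLatticeCarrier.LevelRegular` ((L1), (L3), (F1)) for `b := partialSum m (w + ·)` and
  `D := disp m (w + ·) w` on a refresh window — and
* the flow equation in integral form `D(s, x) = ∫₀ˢ b(r, x + proj D(r, x)) dr` (`IsFlow`, shifted to
  the window by `intervalIntegral.integral_comp_add_right`),
the flow is `X(s) = id + proj ∘ D(s)` and its Jacobian matrix is `J(s, y)_{ac} = δ_{ac} + ∂_c D_a(s, y)`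
(`= frameJac E m (w+s) w y a c` of the cell's `LagrangianStep.frameJac`, read through `fderiv_lift`).
We prove:
* FR1 `isSmooth_flowJac_entry` — every entry `y ↦ J(s,y)_{ac}` is smooth;
* FR2 `continuousOn_stLift_iterPartialDeriv_flowJac_entry` — ALL iterated space derivatives of the
  entries are jointly continuous on `[0,T] × T^d` (Landau interpolation, file
  `TorusDerivativeContinuityInTime`);
* FR4 `hasDerivWithinAt_flowJac_entry` — **the variational equation for every `s ∈ [0,T]`**:
  `∂ₛ J(s,y)_{ac} = Σⱼ (∂ⱼ b_a)(s, X(s,y)) · J(s,y)_{jc}` as a derivative within `[0,T]` (two-sided at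
  interior times), obtained by differentiating the integral form under the integral sign in the space
  variable (`intervalIntegral.hasDerivAt_integral_of_dominated_loc_of_deriv_le`) and the fundamental
  theorem of calculus in `s` — valid for `b` merely continuous in time;
* FR3 `lipschitzOnWith_flowJac_entry` — `s ↦ J(s,y)_{ac}` is Lipschitz on `[0,T]` uniformly in `y, a, c`.

## References

* A. J. Majda, A. L. Bertozzi, *Vorticity and Incompressible Flow* (CUP 2002), §1.3–§1.4 and §4.1
  (particle-trajectory map of a field continuous in time and smooth in space; the equation
  `d/dt ∇ₐX = (∇v)|_X ∇ₐX` for its Jacobian). [`MajdaBertozziCUP2002`]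
* P. Hartman, *Ordinary Differential Equations*, 2nd ed., SIAM 2002, Ch. V, Thm. 3.1 (differentiability
  of solutions with respect to initial data; the variational equation). [`Hartman2002`]
-/

noncomputable section

open Set Filter Topology Function MeasureTheory intervalIntegral
open scoped ContDiff NNReal Interval

namespace Literature.Analysis.ODE

namespace TorusFlow

open Literature.Analysis.FunctionSpaces Literature.Analysis.FunctionSpaces.Torus

variable {d : Type*} [Fintype d] [DecidableEq d]

/-! ## §0 Tools -/

omit [DecidableEq d] in
/-- `‖D(lift u)(y)‖ ≤ C` from the order-one bound `‖D¹(lift u)(y)‖ ≤ C`. [folklore] -/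
private theorem norm_fderiv_lift_le {F : Type*} [NormedAddCommGroup F] [NormedSpace ℝ F]
    {u : UnitAddTorus d → F} {C : ℝ} (h : ∀ y, ‖iteratedFDeriv ℝ 1 (lift u) y‖ ≤ C)
    (y : EuclideanSpace ℝ d) : ‖_root_.fderiv ℝ (lift u) y‖ ≤ C := by
  rw [← norm_iteratedFDeriv_one]; exact h y

/-- `D(lift u)(y) h = Σⱼ hⱼ · (lift ∂ⱼu)(y)`. [folklore] -/
private theorem fderiv_lift_apply_eq_sum {F : Type*} [NormedAddCommGroup F] [NormedSpace ℝ F]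
    {u : UnitAddTorus d → F} (hu : IsContDiff 1 u) (y h : EuclideanSpace ℝ d) :
    _root_.fderiv ℝ (lift u) y h = ∑ j, h j • lift (partialDeriv j u) y := by
  rw [fderiv_lift, fderiv_apply_eq_sum_partialDeriv hu]
  rfl

/-- `D(lift u)(y) e_c = (lift ∂_c u)(y)`. [folklore] -/
private theorem fderiv_lift_single {F : Type*} [NormedAddCommGroup F] [NormedSpace ℝ F]
    {u : UnitAddTorus d → F} (hu : IsContDiff 1 u) (y : EuclideanSpace ℝ d) (c : d) :
    _root_.fderiv ℝ (lift u) y (EuclideanSpace.single c (1 : ℝ)) = lift (partialDeriv c u) y :=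
  (congrFun (lift_lineDeriv hu (EuclideanSpace.single c (1 : ℝ))) y).symm

omit [DecidableEq d] in
/-- A component of a partial derivative is bounded by the first-order lift bound. [folklore] -/
private theorem abs_partialDeriv_apply_le [DecidableEq d] {u : UnitAddTorus d → EuclideanSpace ℝ d}
    (hu : IsSmooth u) {C : ℝ} (h : ∀ y, ‖iteratedFDeriv ℝ 1 (lift u) y‖ ≤ C) (j a : d) (x : UnitAddTorus d) :
    |partialDeriv j (fun z => u z a) x| ≤ C := by
  obtain ⟨y, rfl⟩ := proj_surjective x
  have h1 : IsContDiff 1 u := hu.isContDiff (by simp)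
  rw [partialDeriv_apply_coord h1]
  have e1 : partialDeriv j u (proj y) = _root_.fderiv ℝ (lift u) y (EuclideanSpace.single j (1 : ℝ)) := by
    rw [fderiv_lift_single h1]; rfl
  calc |partialDeriv j u (proj y) a| = ‖partialDeriv j u (proj y) a‖ := (Real.norm_eq_abs _).symm
    _ ≤ ‖partialDeriv j u (proj y)‖ := PiLp.norm_apply_le _ a
    _ = ‖_root_.fderiv ℝ (lift u) y (EuclideanSpace.single j (1 : ℝ))‖ := by rw [e1]
    _ ≤ ‖_root_.fderiv ℝ (lift u) y‖ * ‖(EuclideanSpace.single j (1 : ℝ) : EuclideanSpace ℝ d)‖ :=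
        ContinuousLinearMap.le_opNorm _ _
    _ ≤ C * 1 := by
        rw [show ‖(EuclideanSpace.single j (1 : ℝ) : EuclideanSpace ℝ d)‖ = 1 by simp]
        exact mul_le_mul_of_nonneg_right (norm_fderiv_lift_le h y) zero_le_one
    _ = C := mul_one C

/-! ## §1 FR1 and FR2: smoothness and joint continuity of the Jacobian entries -/

variable {b D : ℝ → UnitAddTorus d → EuclideanSpace ℝ d} {T : ℝ}

/-- **FR1**: every entry `y ↦ J(s,y)_{ac} = δ_{ac} + ∂_c D_a(s,y)` of the flow Jacobian is smooth.
[cite: MajdaBertozziCUP2002, §4.1 (smoothness of the particle-trajectory map in the label)] -/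
theorem isSmooth_flowJac_entry (hDs : ∀ t ∈ Icc 0 T, IsSmooth (D t)) {s : ℝ} (hs : s ∈ Icc 0 T)
    (a c : d) : IsSmooth (fun y => (1 : Matrix d d ℝ) a c + partialDeriv c (fun z => D s z a) y) :=
  (isSmooth_const _).add (((hDs s hs).apply a).partialDeriv c)

omit [DecidableEq d] in
/-- The component fields `(s, y) ↦ D_a(s, y)` inherit the three regularity clauses. [folklore] -/
private theorem component_clauses (hDc : ContinuousOn (stLift D) (Icc 0 T ×ˢ univ))
    (hDs : ∀ t ∈ Icc 0 T, IsSmooth (D t))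
    (hDB : ∀ n : ℕ, ∃ C : ℝ, ∀ t ∈ Icc 0 T, ∀ y, ‖iteratedFDeriv ℝ n (lift (D t)) y‖ ≤ C) (a : d) :
    ContinuousOn (stLift fun s y => D s y a) (Icc 0 T ×ˢ univ) ∧
      (∀ t ∈ Icc 0 T, IsSmooth (fun y => D t y a)) ∧
      ∀ n : ℕ, ∃ C : ℝ, ∀ t ∈ Icc 0 T, ∀ y, ‖iteratedFDeriv ℝ n (lift (fun y => D t y a)) y‖ ≤ C := by
  refine ⟨(EuclideanSpace.proj a).continuous.comp_continuousOn hDc, fun t ht => (hDs t ht).apply a, fun n => ?_⟩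
  obtain ⟨C, hC⟩ := hDB n
  refine ⟨C, fun t ht y => ?_⟩
  have e1 : lift (fun y => D t y a) = (EuclideanSpace.proj a : EuclideanSpace ℝ d →L[ℝ] ℝ) ∘ lift (D t) := rfl
  rw [e1]
  have hcd : ContDiff ℝ ∞ (lift (D t)) := hDs t ht
  calc ‖iteratedFDeriv ℝ n ((EuclideanSpace.proj a : EuclideanSpace ℝ d →L[ℝ] ℝ) ∘ lift (D t)) y‖
      ≤ ‖(EuclideanSpace.proj a : EuclideanSpace ℝ d →L[ℝ] ℝ)‖ * ‖iteratedFDeriv ℝ n (lift (D t)) y‖ :=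
        ContinuousLinearMap.norm_iteratedFDeriv_comp_left _ hcd.contDiffAt (by exact_mod_cast le_top)
    _ ≤ 1 * C := by
        refine mul_le_mul ?_ (hC t ht y) (norm_nonneg _) zero_le_one
        exact ContinuousLinearMap.opNorm_le_bound _ zero_le_one fun v => by
          rw [one_mul]; exact PiLp.norm_apply_le v a
    _ = C := one_mul C

/-- **FR2**: all iterated space derivatives of the Jacobian entries `J(s,·)_{ac}` are jointly continuous
on `[0,T] × T^d` (space–time lift continuous on `[0,T] × ℝ^d`).
[cite: MajdaBertozziCUP2002, §4.1 (regularity of the particle-trajectory map); Landau1913, Satz 1] -/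
theorem continuousOn_stLift_iterPartialDeriv_flowJac_entry (hDc : ContinuousOn (stLift D) (Icc 0 T ×ˢ univ))
    (hDs : ∀ t ∈ Icc 0 T, IsSmooth (D t))
    (hDB : ∀ n : ℕ, ∃ C : ℝ, ∀ t ∈ Icc 0 T, ∀ y, ‖iteratedFDeriv ℝ n (lift (D t)) y‖ ≤ C)
    (a c : d) (l : List d) :
    ContinuousOn (stLift fun s y => iterPartialDeriv l
      (fun y => (1 : Matrix d d ℝ) a c + partialDeriv c (fun z => D s z a) y) y) (Icc 0 T ×ˢ univ) := by
  obtain ⟨hc, hsm, hB⟩ := component_clauses hDc hDs hDB a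
  -- the entry `δ_{ac} + ∂_c D_a` satisfies the three clauses
  obtain ⟨hc1, hB1⟩ := continuousOn_stLift_iterPartialDeriv_and_bounds hc hsm hB [c]
  have hcE : ContinuousOn (stLift fun s y => (1 : Matrix d d ℝ) a c + partialDeriv c (fun z => D s z a) y)
      (Icc 0 T ×ˢ univ) := by
    have e : stLift (fun s y => (1 : Matrix d d ℝ) a c + partialDeriv c (fun z => D s z a) y) =
        fun p => (1 : Matrix d d ℝ) a c + stLift (fun s => iterPartialDeriv [c] (fun y => D s y a)) p := by
      funext p; rfl
    rw [e]
    exact continuousOn_const.add hc1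
  have hsE : ∀ t ∈ Icc 0 T, IsSmooth (fun y => (1 : Matrix d d ℝ) a c + partialDeriv c (fun z => D t z a) y) :=
    fun t ht => isSmooth_flowJac_entry hDs ht a c
  have hBE : ∀ n : ℕ, ∃ C : ℝ, ∀ t ∈ Icc 0 T, ∀ y,
      ‖iteratedFDeriv ℝ n (lift fun y => (1 : Matrix d d ℝ) a c + partialDeriv c (fun z => D t z a) y) y‖ ≤ C := by
    intro n
    obtain ⟨C, hC⟩ := hB1 n
    refine ⟨|(1 : Matrix d d ℝ) a c| + C, fun t ht y => ?_⟩
    have e : (lift fun y => (1 : Matrix d d ℝ) a c + partialDeriv c (fun z => D t z a) y) =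
        (fun _ => (1 : Matrix d d ℝ) a c) + lift (iterPartialDeriv [c] (fun y => D t y a)) := by
      funext z; rfl
    have hcd : ContDiff ℝ ∞ (lift (iterPartialDeriv [c] (fun y => D t y a))) := (hsm t ht).iterPartialDeriv [c]
    rw [e, iteratedFDeriv_add_apply contDiff_const.contDiffAt (hcd.of_le (by exact_mod_cast le_top)).contDiffAt]
    refine (norm_add_le _ _).trans (add_le_add ?_ (hC t ht y))
    rcases Nat.eq_zero_or_pos n with hn | hn
    · subst hn
      simp
    · rw [iteratedFDeriv_const_of_ne (by omega)]
      simp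
  exact continuousOn_stLift_iterPartialDeriv hcE hsE hBE l

/-! ## §2 FR4: the variational equation for every `s ∈ [0,T]` -/

omit [DecidableEq d] in
/-- Continuity in time of the Lagrangian velocity along a line of labels:
`r ↦ b(r, ṽ + D(r, ṽ))` (lifted) is continuous on `[0,T]`. [folklore] -/
private theorem continuousOn_lagVel (hbc : ContinuousOn (stLift b) (Icc 0 T ×ˢ univ))
    (hDc : ContinuousOn (stLift D) (Icc 0 T ×ˢ univ)) (v : EuclideanSpace ℝ d) :
    ContinuousOn (fun r => lift (b r) (v + lift (D r) v)) (Icc 0 T) := by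
  have hw : ContinuousOn (fun r => v + lift (D r) v) (Icc 0 T) := by
    refine continuousOn_const.add ?_
    exact hDc.comp (continuous_id.prodMk continuous_const).continuousOn fun r hr => mk_mem_prod hr (mem_univ _)
  exact hbc.comp (continuousOn_id.prodMk hw) fun r hr => mk_mem_prod hr (mem_univ _)

/-- Continuity in time of the integrand of the variational equation:
`r ↦ D(lift b r)(ṽ + D(r,ṽ)) (e_c + D(lift D r)(ṽ) e_c)` is continuous on `[0,T]`. [folklore] -/
private theorem continuousOn_varIntegrand (hbc : ContinuousOn (stLift b) (Icc 0 T ×ˢ univ))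
    (hbs : ∀ t ∈ Icc 0 T, IsSmooth (b t))
    (hbB : ∀ n : ℕ, ∃ C : ℝ, ∀ t ∈ Icc 0 T, ∀ y, ‖iteratedFDeriv ℝ n (lift (b t)) y‖ ≤ C)
    (hDc : ContinuousOn (stLift D) (Icc 0 T ×ˢ univ)) (hDs : ∀ t ∈ Icc 0 T, IsSmooth (D t))
    (hDB : ∀ n : ℕ, ∃ C : ℝ, ∀ t ∈ Icc 0 T, ∀ y, ‖iteratedFDeriv ℝ n (lift (D t)) y‖ ≤ C)
    (v : EuclideanSpace ℝ d) (c : d) :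
    ContinuousOn (fun r => _root_.fderiv ℝ (lift (b r)) (v + lift (D r) v)
      (EuclideanSpace.single c (1 : ℝ) + _root_.fderiv ℝ (lift (D r)) v (EuclideanSpace.single c (1 : ℝ))))
      (Icc 0 T) := by
  have hb1 : ∀ r ∈ Icc 0 T, IsContDiff 1 (b r) := fun r hr => (hbs r hr).isContDiff (by simp)
  have hD1 : ∀ r ∈ Icc 0 T, IsContDiff 1 (D r) := fun r hr => (hDs r hr).isContDiff (by simp)
  -- continuity of the first space derivatives (interpolation upgrade)
  have hAb : ∀ j, ContinuousOn (stLift fun r => partialDeriv j (b r)) (Icc 0 T ×ˢ univ) := fun j => by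
    simpa using continuousOn_stLift_iterPartialDeriv hbc hbs hbB [j]
  have hAD : ContinuousOn (stLift fun r => partialDeriv c (D r)) (Icc 0 T ×ˢ univ) := by
    simpa using continuousOn_stLift_iterPartialDeriv hDc hDs hDB [c]
  have hw : ContinuousOn (fun r => v + lift (D r) v) (Icc 0 T) := by
    refine continuousOn_const.add ?_
    exact hDc.comp (continuous_id.prodMk continuous_const).continuousOn fun r hr => mk_mem_prod hr (mem_univ _)
  have hformula : ∀ r ∈ Icc 0 T, _root_.fderiv ℝ (lift (b r)) (v + lift (D r) v)
      (EuclideanSpace.single c (1 : ℝ) + _root_.fderiv ℝ (lift (D r)) v (EuclideanSpace.single c (1 : ℝ))) =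
      ∑ j, (EuclideanSpace.single c (1 : ℝ) + lift (partialDeriv c (D r)) v) j •
        lift (partialDeriv j (b r)) (v + lift (D r) v) := by
    intro r hr
    rw [fderiv_lift_single (hD1 r hr), fderiv_lift_apply_eq_sum (hb1 r hr)]
  refine ContinuousOn.congr (f := fun r => ∑ j, (EuclideanSpace.single c (1 : ℝ) + lift (partialDeriv c (D r)) v) j •
        lift (partialDeriv j (b r)) (v + lift (D r) v)) ?_ hformula
  refine continuousOn_finsetSum _ fun j _ => ?_
  have h1 : ContinuousOn (fun r => EuclideanSpace.single c (1 : ℝ) + lift (partialDeriv c (D r)) v) (Icc 0 T) := by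
    refine continuousOn_const.add ?_
    exact hAD.comp (continuous_id.prodMk continuous_const).continuousOn fun r hr => mk_mem_prod hr (mem_univ _)
  have h1' : ContinuousOn (fun r => (EuclideanSpace.single c (1 : ℝ) + lift (partialDeriv c (D r)) v) j) (Icc 0 T) :=
    (EuclideanSpace.proj j).continuous.comp_continuousOn h1
  have h2' : ContinuousOn (fun r => lift (partialDeriv j (b r)) (v + lift (D r) v)) (Icc 0 T) :=
    (hAb j).comp (continuousOn_id.prodMk hw) fun r hr => mk_mem_prod hr (mem_univ _)
  exact h1'.smul h2'

/-- **The label derivative of the displacement is the time integral of the variational integrand**: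
for `s ∈ [0,T]` and a label `x = proj ṽ`,
`∂_c D(s, x) = ∫₀ˢ D(lift b r)(ṽ + D(r,ṽ)) (e_c + D(lift D r)(ṽ) e_c) dr`
(differentiation of the integral form under the integral sign along the label line `ṽ + τ e_c`).
[cite: Hartman2002, Ch. V Thm. 3.1 (proof: differentiation of the integral equation)] -/
theorem partialDeriv_disp_eq_integral (hbc : ContinuousOn (stLift b) (Icc 0 T ×ˢ univ))
    (hbs : ∀ t ∈ Icc 0 T, IsSmooth (b t))
    (hbB : ∀ n : ℕ, ∃ C : ℝ, ∀ t ∈ Icc 0 T, ∀ y, ‖iteratedFDeriv ℝ n (lift (b t)) y‖ ≤ C)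
    (hDc : ContinuousOn (stLift D) (Icc 0 T ×ˢ univ)) (hDs : ∀ t ∈ Icc 0 T, IsSmooth (D t))
    (hDB : ∀ n : ℕ, ∃ C : ℝ, ∀ t ∈ Icc 0 T, ∀ y, ‖iteratedFDeriv ℝ n (lift (D t)) y‖ ≤ C)
    (hint : ∀ s ∈ Icc 0 T, ∀ x, D s x = ∫ r in (0 : ℝ)..s, b r (x + proj (D r x)))
    {s : ℝ} (hs : s ∈ Icc 0 T) (v : EuclideanSpace ℝ d) (c : d) :
    partialDeriv c (D s) (proj v) = ∫ r in (0 : ℝ)..s, _root_.fderiv ℝ (lift (b r)) (v + lift (D r) v)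
      (EuclideanSpace.single c (1 : ℝ) + _root_.fderiv ℝ (lift (D r)) v (EuclideanSpace.single c (1 : ℝ))) := by
  have h0T : (0 : ℝ) ∈ Icc 0 T := ⟨le_rfl, hs.1.trans hs.2⟩
  have hsub : Ι 0 s ⊆ Icc 0 T := uIoc_subset_uIcc.trans (uIcc_subset_Icc h0T hs)
  have hsub' : uIcc 0 s ⊆ Icc 0 T := uIcc_subset_Icc h0T hs
  obtain ⟨Cb, hCb⟩ := hbB 1
  obtain ⟨CD, hCD⟩ := hDB 1
  set e : EuclideanSpace ℝ d := EuclideanSpace.single c (1 : ℝ) with he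
  have hne : ‖e‖ = 1 := by simp [he]
  -- the parametrised family along the label line `v + τ e`
  set F : ℝ → ℝ → EuclideanSpace ℝ d := fun τ r => lift (b r) ((v + τ • e) + lift (D r) (v + τ • e)) with hF
  set F' : ℝ → ℝ → EuclideanSpace ℝ d := fun τ r =>
    _root_.fderiv ℝ (lift (b r)) ((v + τ • e) + lift (D r) (v + τ • e))
      (e + _root_.fderiv ℝ (lift (D r)) (v + τ • e) e) with hF'
  have hdiffb : ∀ r ∈ Icc 0 T, Differentiable ℝ (lift (b r)) := fun r hr => by
    have h : ContDiff ℝ ∞ (lift (b r)) := hbs r hr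
    exact h.differentiable (by simp)
  have hdiffD : ∀ r ∈ Icc 0 T, Differentiable ℝ (lift (D r)) := fun r hr => by
    have h : ContDiff ℝ ∞ (lift (D r)) := hDs r hr
    exact h.differentiable (by simp)
  -- (i) derivative in `τ` of the family
  have hderiv : ∀ r ∈ Icc 0 T, ∀ τ, HasDerivAt (fun τ => F τ r) (F' τ r) τ := by
    intro r hr τ
    have hℓ : HasDerivAt (fun τ : ℝ => v + τ • e) e τ := by
      simpa using ((hasDerivAt_id τ).smul_const e).const_add v
    have hγ : HasDerivAt (fun τ : ℝ => (v + τ • e) + lift (D r) (v + τ • e))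
        (e + _root_.fderiv ℝ (lift (D r)) (v + τ • e) e) τ := by
      have h2 := ((hdiffD r hr) (v + τ • e)).hasFDerivAt.comp_hasDerivAt τ hℓ
      exact hℓ.add h2
    have h3 := ((hdiffb r hr) ((v + τ • e) + lift (D r) (v + τ • e))).hasFDerivAt.comp_hasDerivAt τ hγ
    exact h3
  -- (ii) the bound on `F'`
  have hbound : ∀ r ∈ Icc 0 T, ∀ τ, ‖F' τ r‖ ≤ Cb * (1 + CD) := by
    intro r hr τ
    have h1 := norm_fderiv_lift_le (hCb r hr) ((v + τ • e) + lift (D r) (v + τ • e))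
    have h2 := norm_fderiv_lift_le (hCD r hr) (v + τ • e)
    have hCb0 : 0 ≤ Cb := (norm_nonneg _).trans h1
    calc ‖F' τ r‖ ≤ ‖_root_.fderiv ℝ (lift (b r)) ((v + τ • e) + lift (D r) (v + τ • e))‖ *
          ‖e + _root_.fderiv ℝ (lift (D r)) (v + τ • e) e‖ := ContinuousLinearMap.le_opNorm _ _
      _ ≤ Cb * (1 + CD) := by
          refine mul_le_mul h1 ?_ (norm_nonneg _) hCb0
          have h3 := ContinuousLinearMap.le_opNorm (_root_.fderiv ℝ (lift (D r)) (v + τ • e)) e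
          rw [hne, mul_one] at h3
          calc ‖e + _root_.fderiv ℝ (lift (D r)) (v + τ • e) e‖
              ≤ ‖e‖ + ‖_root_.fderiv ℝ (lift (D r)) (v + τ • e) e‖ := norm_add_le _ _
            _ ≤ 1 + CD := by rw [hne]; exact add_le_add le_rfl (h3.trans h2)
  -- (iii) measurability / integrability from continuity in `r`
  have hFcont : ∀ τ, ContinuousOn (F τ) (Icc 0 T) := fun τ => continuousOn_lagVel hbc hDc (v + τ • e)
  have hF'cont : ContinuousOn (F' 0) (Icc 0 T) := by
    have h := continuousOn_varIntegrand hbc hbs hbB hDc hDs hDB (v + (0 : ℝ) • e) c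
    simpa [hF'] using h
  have hmain := intervalIntegral.hasDerivAt_integral_of_dominated_loc_of_deriv_le (μ := volume)
    (F := F) (F' := F') (x₀ := (0 : ℝ)) (a := 0) (b := s) (s := univ) (bound := fun _ => Cb * (1 + CD))
    univ_mem
    (Eventually.of_forall fun τ => ((hFcont τ).mono hsub).aestronglyMeasurable measurableSet_uIoc)
    (((hFcont 0).mono hsub').intervalIntegrable)
    ((hF'cont.mono hsub).aestronglyMeasurable measurableSet_uIoc)
    (Eventually.of_forall fun r hr τ _ => hbound r (hsub hr) τ)
    intervalIntegrable_const
    (Eventually.of_forall fun r hr τ _ => hderiv r (hsub hr) τ)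
  -- (iv) the family integrates to the displacement along the label line
  have hFint : ∀ τ, ∫ r in (0 : ℝ)..s, F τ r = lift (D s) (v + τ • e) := by
    intro τ
    rw [lift_apply, hint s hs (proj (v + τ • e))]
    rfl
  have hD' : HasDerivAt (fun τ : ℝ => lift (D s) (v + τ • e)) (∫ r in (0 : ℝ)..s, F' 0 r) 0 := by
    have h := hmain.2
    simp only [hFint] at h
    exact h
  -- (v) the torus partial derivative is the `τ`-derivative at `0`
  have hpd : partialDeriv c (D s) (proj v) = deriv (fun τ : ℝ => lift (D s) (v + τ • e)) 0 := by
    show deriv (fun τ : ℝ => D s (proj v + proj (τ • EuclideanSpace.single c (1 : ℝ)))) 0 = _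
    rfl
  rw [hpd, hD'.deriv]
  simp [hF']

/-- **FR4 — the variational equation, for EVERY time in the window.** For `s ∈ [0,T]`, a label `x`
and indices `a, c`, the Jacobian entry `J(s,x)_{ac} = δ_{ac} + ∂_c D_a(s,x)` has, within `[0,T]`, the
time derivative `Σⱼ (∂ⱼ b_a)(s, X(s,x)) · J(s,x)_{jc}` — i.e. `∂ₛ J = (∇b)(s, X) · J` — although `b` is
only continuous in time. [cite: MajdaBertozziCUP2002, §4.1 (d/dt ∇ₐX = (∇v)|_X ∇ₐX); Hartman2002, Ch. V Thm. 3.1] -/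
theorem hasDerivWithinAt_flowJac_entry (hbc : ContinuousOn (stLift b) (Icc 0 T ×ˢ univ))
    (hbs : ∀ t ∈ Icc 0 T, IsSmooth (b t))
    (hbB : ∀ n : ℕ, ∃ C : ℝ, ∀ t ∈ Icc 0 T, ∀ y, ‖iteratedFDeriv ℝ n (lift (b t)) y‖ ≤ C)
    (hDc : ContinuousOn (stLift D) (Icc 0 T ×ˢ univ)) (hDs : ∀ t ∈ Icc 0 T, IsSmooth (D t))
    (hDB : ∀ n : ℕ, ∃ C : ℝ, ∀ t ∈ Icc 0 T, ∀ y, ‖iteratedFDeriv ℝ n (lift (D t)) y‖ ≤ C)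
    (hint : ∀ s ∈ Icc 0 T, ∀ x, D s x = ∫ r in (0 : ℝ)..s, b r (x + proj (D r x)))
    {s : ℝ} (hs : s ∈ Icc 0 T) (x : UnitAddTorus d) (a c : d) :
    HasDerivWithinAt (fun s => (1 : Matrix d d ℝ) a c + partialDeriv c (fun z => D s z a) x)
      (∑ j, partialDeriv j (fun z => b s z a) (x + proj (D s x)) *
        ((1 : Matrix d d ℝ) j c + partialDeriv c (fun z => D s z j) x)) (Icc 0 T) s := by
  obtain ⟨v, rfl⟩ := proj_surjective x
  set e : EuclideanSpace ℝ d := EuclideanSpace.single c (1 : ℝ) with he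
  -- the variational integrand and its continuity
  set g : ℝ → EuclideanSpace ℝ d := fun r => _root_.fderiv ℝ (lift (b r)) (v + lift (D r) v)
    (e + _root_.fderiv ℝ (lift (D r)) v e) with hg
  have hgc : ContinuousOn g (Icc 0 T) := continuousOn_varIntegrand hbc hbs hbB hDc hDs hDB v c
  have h0T : (0 : ℝ) ∈ Icc 0 T := ⟨le_rfl, hs.1.trans hs.2⟩
  -- FTC within `[0,T]`
  haveI : Fact (s ∈ Icc 0 T) := ⟨hs⟩
  have hFTC : HasDerivWithinAt (fun u => ∫ r in (0 : ℝ)..u, g r) (g s) (Icc 0 T) s :=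
    intervalIntegral.integral_hasDerivWithinAt_right ((hgc.mono (uIcc_subset_Icc h0T hs)).intervalIntegrable)
      (hgc.stronglyMeasurableAtFilter_nhdsWithin measurableSet_Icc s) (hgc s hs)
  -- the vector `∂_c D(u, x)` equals the integral on `[0,T]`
  have hvec : HasDerivWithinAt (fun u => partialDeriv c (D u) (proj v)) (g s) (Icc 0 T) s := by
    refine hFTC.congr (fun u hu => ?_) ?_
    · exact partialDeriv_disp_eq_integral hbc hbs hbB hDc hDs hDB hint hu v c
    · exact partialDeriv_disp_eq_integral hbc hbs hbB hDc hDs hDB hint hs v c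
  -- take the `a`-th component and add the constant `δ_{ac}`
  have hcomp : HasDerivWithinAt (fun u => (1 : Matrix d d ℝ) a c + (partialDeriv c (D u) (proj v)) a)
      ((g s) a) (Icc 0 T) s := by
    have h1 := ((EuclideanSpace.proj a : EuclideanSpace ℝ d →L[ℝ] ℝ).hasFDerivAt).comp_hasDerivWithinAt s hvec
    exact h1.const_add _
  have hD1 : ∀ u ∈ Icc 0 T, IsContDiff 1 (D u) := fun u hu => (hDs u hu).isContDiff (by simp)
  have hb1 : IsContDiff 1 (b s) := (hbs s hs).isContDiff (by simp)
  refine (hcomp.congr (fun u hu => by rw [partialDeriv_apply_coord (hD1 u hu)])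
    (by rw [partialDeriv_apply_coord (hD1 s hs)])).congr_deriv ?_
  -- identify the value `(g s)_a = Σⱼ ∂ⱼb_a(s, X) J_{jc}`
  rw [hg]
  simp only
  rw [fderiv_lift_single (hD1 s hs), fderiv_lift_apply_eq_sum hb1]
  rw [WithLp.ofLp_sum, Finset.sum_apply]
  refine Finset.sum_congr rfl fun j _ => ?_
  rw [WithLp.ofLp_smul, Pi.smul_apply, smul_eq_mul, mul_comm]
  congr 1
  · rw [partialDeriv_apply_coord hb1, lift_apply, proj_add]
    rfl
  · rw [PiLp.add_apply, partialDeriv_apply_coord (hD1 s hs), lift_apply, Matrix.one_apply, he,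
      show (EuclideanSpace.single c (1 : ℝ) : EuclideanSpace ℝ d) j = if j = c then 1 else 0 from
        PiLp.single_apply 2 ℝ c 1 j]

/-- **FR4, interior times**: at `s ∈ (0,T)` the variational equation holds as a two-sided derivative.
[cite: MajdaBertozziCUP2002, §4.1; Hartman2002, Ch. V Thm. 3.1] -/
theorem hasDerivAt_flowJac_entry (hbc : ContinuousOn (stLift b) (Icc 0 T ×ˢ univ))
    (hbs : ∀ t ∈ Icc 0 T, IsSmooth (b t))
    (hbB : ∀ n : ℕ, ∃ C : ℝ, ∀ t ∈ Icc 0 T, ∀ y, ‖iteratedFDeriv ℝ n (lift (b t)) y‖ ≤ C)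
    (hDc : ContinuousOn (stLift D) (Icc 0 T ×ˢ univ)) (hDs : ∀ t ∈ Icc 0 T, IsSmooth (D t))
    (hDB : ∀ n : ℕ, ∃ C : ℝ, ∀ t ∈ Icc 0 T, ∀ y, ‖iteratedFDeriv ℝ n (lift (D t)) y‖ ≤ C)
    (hint : ∀ s ∈ Icc 0 T, ∀ x, D s x = ∫ r in (0 : ℝ)..s, b r (x + proj (D r x)))
    {s : ℝ} (hs : s ∈ Ioo 0 T) (x : UnitAddTorus d) (a c : d) :
    HasDerivAt (fun s => (1 : Matrix d d ℝ) a c + partialDeriv c (fun z => D s z a) x)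
      (∑ j, partialDeriv j (fun z => b s z a) (x + proj (D s x)) *
        ((1 : Matrix d d ℝ) j c + partialDeriv c (fun z => D s z j) x)) s :=
  (hasDerivWithinAt_flowJac_entry hbc hbs hbB hDc hDs hDB hint (Ioo_subset_Icc_self hs) x a c).hasDerivAt
    (Icc_mem_nhds hs.1 hs.2)

/-! ## §3 FR3: Lipschitz continuity in time, uniformly in the label -/

/-- **FR3**: the Jacobian entries are Lipschitz in time on `[0,T]`, uniformly in the label and the
indices, with constant `d · C_b¹ · (1 + C_D¹)` from the first-order bounds.
[cite: MajdaBertozziCUP2002, §4.1 (bounds on ∇X from bounds on ∇v)] -/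
theorem lipschitzOnWith_flowJac_entry (hbc : ContinuousOn (stLift b) (Icc 0 T ×ˢ univ))
    (hbs : ∀ t ∈ Icc 0 T, IsSmooth (b t))
    (hbB : ∀ n : ℕ, ∃ C : ℝ, ∀ t ∈ Icc 0 T, ∀ y, ‖iteratedFDeriv ℝ n (lift (b t)) y‖ ≤ C)
    (hDc : ContinuousOn (stLift D) (Icc 0 T ×ˢ univ)) (hDs : ∀ t ∈ Icc 0 T, IsSmooth (D t))
    (hDB : ∀ n : ℕ, ∃ C : ℝ, ∀ t ∈ Icc 0 T, ∀ y, ‖iteratedFDeriv ℝ n (lift (D t)) y‖ ≤ C)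
    (hint : ∀ s ∈ Icc 0 T, ∀ x, D s x = ∫ r in (0 : ℝ)..s, b r (x + proj (D r x))) :
    ∃ K : ℝ≥0, ∀ (x : UnitAddTorus d) (a c : d),
      LipschitzOnWith K (fun s => (1 : Matrix d d ℝ) a c + partialDeriv c (fun z => D s z a) x) (Icc 0 T) := by
  obtain ⟨Cb, hCb⟩ := hbB 1
  obtain ⟨CD, hCD⟩ := hDB 1
  set K : ℝ := (Fintype.card d : ℝ) * (|Cb| * (1 + |CD|)) with hK
  have hK0 : 0 ≤ K := by positivity
  refine ⟨⟨K, hK0⟩, fun x a c => ?_⟩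
  refine Convex.lipschitzOnWith_of_nnnorm_hasDerivWithin_le (convex_Icc 0 T)
    (fun s hs => hasDerivWithinAt_flowJac_entry hbc hbs hbB hDc hDs hDB hint hs x a c) fun s hs => ?_
  rw [← NNReal.coe_le_coe, coe_nnnorm]
  show ‖_‖ ≤ K
  rw [Real.norm_eq_abs]
  calc |∑ j, partialDeriv j (fun z => b s z a) (x + proj (D s x)) *
        ((1 : Matrix d d ℝ) j c + partialDeriv c (fun z => D s z j) x)|
      ≤ ∑ j, |partialDeriv j (fun z => b s z a) (x + proj (D s x)) *
        ((1 : Matrix d d ℝ) j c + partialDeriv c (fun z => D s z j) x)| := Finset.abs_sum_le_sum_abs _ _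
    _ ≤ ∑ _j : d, |Cb| * (1 + |CD|) := Finset.sum_le_sum fun j _ => by
        rw [abs_mul]
        refine mul_le_mul ((abs_partialDeriv_apply_le (hbs s hs) (hCb s hs) j a _).trans (le_abs_self _)) ?_
          (abs_nonneg _) (abs_nonneg _)
        calc |(1 : Matrix d d ℝ) j c + partialDeriv c (fun z => D s z j) x|
            ≤ |(1 : Matrix d d ℝ) j c| + |partialDeriv c (fun z => D s z j) x| := abs_add_le _ _
          _ ≤ 1 + |CD| := add_le_add (by rw [Matrix.one_apply]; split_ifs <;> simp)
              ((abs_partialDeriv_apply_le (hDs s hs) (hCD s hs) c j x).trans (le_abs_self _))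
    _ = K := by rw [Finset.sum_const, Finset.card_univ, nsmul_eq_mul, hK]

end TorusFlow

end Literature.Analysis.ODE

end
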